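import Literature.MathematicalPhysics.QuantumFieldTheory.QCDOS
import Literature.MathematicalPhysics.QuantumFieldTheory.QCDSiteReflectionPositivityProofs
import HarnessLib

/-!
# Stub `stub_local_bilinear_eq_quadratic` of line `pin-the-infimum` (crux `RobustYangMillsHandover`, 8892)

E2 (fermionic insertions in Lüscher's transfer form), layer γ2: **local quark bilinears are
`quadratic`s.**

The source trick `∫ X · (ψ̄ J ψ) · e^{−ψ̄Dψ} = d/ds|₀ ∫ X e^{ψ̄(−D + sJ)ψ}` is stated for insertions of
the form `quadratic ℂ J = ∑ᵢⱼ Jᵢⱼ ψ̄ᵢ ψⱼ` (`i, j` in the tree's linear quark index `FermiIdx Nf L`).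
The meson operators of the Statement are single-site colour-singlet bilinears
`∑_{a,α,β} Γs_{αβ} ψ̄_{f,x,a,α} ψ_{g,x,a,β}` (Montvay–Münster §5.1), in particular the pseudoscalars
`pseudoscalarBilinear f g x` (`Γs = iγ₅`).  This file identifies them with `quadratic ℂ J` for the
explicit source matrix `J` on `FermiIdx Nf L` supported on the quark variables of flavours `(f, g)`
at the site `x`, colour-diagonal, with spin matrix `Γs` (pulled back along `quarkEquiv`):

* conjunct 1: the general spin matrix `Γs`;
* conjunct 2: `pseudoscalarBilinear f g x`, i.e. conjunct 1 with the entries `Complex.I * gammaFive α β`.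

## Proof

Reindex the double sum of `quadratic` from `FermiIdx` to `QuarkVar = flavour × (site × colour × spin)`
along `quarkEquiv` (the tree's `quadratic_eq_sum_quarkVar`), expand the sums over the product type
(`Fintype.sum_prod_type`) and collapse the five guards `f' = f`, `x' = x`, `g' = g`, `x'' = x`,
`a'' = a'` one after the other with `Fintype.sum_eq_single`; what is left is the colour/spin sum
`∑_{a,α,β}`.  Conjunct 2 is conjunct 1 for `Γs := Matrix.of fun α β => Complex.I * gammaFive α β`
after unfolding `pseudoscalarBilinear`.

Pure theorem file (no definitions); Mathlib plus the tree's `QCDOS` definitions and the reindexing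
lemma `quadratic_eq_sum_quarkVar` of `QCDSiteReflectionPositivityProofs`.

References: I. Montvay, G. Münster, *Quantum Fields on a Lattice* (CUP 1994), §4.1 (4.14) (the
bilinear `ψ̄ A ψ`), §5.1 (lattice QCD action and meson fields `ψ̄_f Γ ψ_g`).
-/

namespace Summit.QuantumFields.QCD.Cruxes.RobustYangMillsHandover.PinTheInfimum

open Literature.MathematicalPhysics.QuantumLattice Literature.MathematicalPhysics.QuantumFieldTheory
open Literature.Probability.LatticeModels (TorusSite)

namespace StubLocalBilinearEqQuadratic

variable {Nf L : ℕ} [NeZero L]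

/-- Collapsing the guarded double sum over quark variables: the guard
`v = (f, (x, a, α))`, `w = (g, (x, a, β))` (common colour `a`) leaves the colour/spin sum
`∑_{a,α,β} Γs_{αβ} F (f,(x,a,α)) (g,(x,a,β))`. [folklore] -/
theorem sum_sum_guard_smul {M : Type*} [AddCommMonoid M] [Module ℂ M]
    (Γs : Matrix (Fin 4) (Fin 4) ℂ) (f g : Fin Nf) (x : TorusSite 4 L)
    (F : QuarkVar Nf L → QuarkVar Nf L → M) :
    (∑ v : QuarkVar Nf L, ∑ w : QuarkVar Nf L,
        (if v.1 = f ∧ w.1 = g ∧ v.2.1 = x ∧ w.2.1 = x ∧ v.2.2.1 = w.2.2.1 then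
            Γs v.2.2.2 w.2.2.2 else 0) • F v w) =
      ∑ a : Fin 3, ∑ α : Fin 4, ∑ β : Fin 4, Γs α β • F (f, (x, a, α)) (g, (x, a, β)) := by
  simp only [QuarkVar, Fintype.sum_prod_type]
  rw [Fintype.sum_eq_single f fun f' hf' => by simp [hf'],
    Fintype.sum_eq_single x fun x' hx' => by simp [hx']]
  refine Finset.sum_congr rfl fun a _ => Finset.sum_congr rfl fun α _ => ?_
  rw [Fintype.sum_eq_single g fun g' hg' => by simp [hg'],
    Fintype.sum_eq_single x fun x' hx' => by simp [hx'],
    Fintype.sum_eq_single a fun a' ha' => by simp [Ne.symm ha']]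
  exact Finset.sum_congr rfl fun β _ => by simp

/-- **A local quark bilinear is a `quadratic`.**  For a spin matrix `Γs`, flavours `f, g` and a
site `x`, `∑_{a,α,β} Γs_{αβ} ψ̄_{f,x,a,α} ψ_{g,x,a,β} = ψ̄ J ψ` with the source matrix
`J_{ij} = [i = (f,x,a,α), j = (g,x,a,β) for some common colour a] Γs_{αβ}` on the linear quark
index. [cite: MontvayMunster1994, §5.1] -/
theorem local_bilinear_eq_quadratic (Γs : Matrix (Fin 4) (Fin 4) ℂ) (f g : Fin Nf)
    (x : TorusSite 4 L) :
    (∑ a : Fin 3, ∑ α : Fin 4, ∑ β : Fin 4,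
        Γs α β • (qbar (f, (x, a, α)) * q (g, (x, a, β)) : FermiAlg Nf L)) =
      quadratic ℂ (Matrix.of fun i j : FermiIdx Nf L =>
        if (quarkEquiv.symm i).1 = f ∧ (quarkEquiv.symm j).1 = g ∧ (quarkEquiv.symm i).2.1 = x ∧
            (quarkEquiv.symm j).2.1 = x ∧ (quarkEquiv.symm i).2.2.1 = (quarkEquiv.symm j).2.2.1 then
          Γs (quarkEquiv.symm i).2.2.2 (quarkEquiv.symm j).2.2.2 else 0) := by
  rw [quadratic_eq_sum_quarkVar]
  simp only [Matrix.of_apply, Equiv.symm_apply_apply]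
  exact (sum_sum_guard_smul Γs f g x fun v w => qbar v * q w).symm

end StubLocalBilinearEqQuadratic

/-- **E2 γ2: local quark bilinears are `quadratic`s.**  For `N_f` flavours on the four-torus of
side `L`, a spin matrix `Γs`, flavours `f, g` and a site `x`: (1) the single-site colour-singlet
bilinear `∑_{a,α,β} Γs_{αβ} ψ̄_{f,x,a,α} ψ_{g,x,a,β}` equals `quadratic ℂ J` for the source matrix
`J` on `FermiIdx Nf L` supported on flavours `(f, g)` at site `x`, colour-diagonal, spin matrix
`Γs`; (2) the pseudoscalar `P_{fg}(x) = ψ̄_f iγ₅ ψ_g (x)` of `QCDOS` is the case with entries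
`i (γ₅)_{αβ}`.  The statement is the registered stub signature verbatim.
[cite: MontvayMunster1994, §5.1] -/
theorem stub_local_bilinear_eq_quadratic :
    ∀ (Nf L : ℕ) [NeZero L] (Γs : Matrix (Fin 4) (Fin 4) ℂ) (f g : Fin Nf) (x : TorusSite 4 L),
      (∑ a : Fin 3, ∑ α : Fin 4, ∑ β : Fin 4, Γs α β • (qbar (f, (x, a, α)) * q (g, (x, a, β)) : FermiAlg Nf L)) =
        quadratic ℂ (Matrix.of fun i j : FermiIdx Nf L =>
          if (quarkEquiv.symm i).1 = f ∧ (quarkEquiv.symm j).1 = g ∧ (quarkEquiv.symm i).2.1 = x ∧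
              (quarkEquiv.symm j).2.1 = x ∧ (quarkEquiv.symm i).2.2.1 = (quarkEquiv.symm j).2.2.1 then
            Γs (quarkEquiv.symm i).2.2.2 (quarkEquiv.symm j).2.2.2 else 0) ∧
      (pseudoscalarBilinear f g x : FermiAlg Nf L) =
        quadratic ℂ (Matrix.of fun i j : FermiIdx Nf L =>
          if (quarkEquiv.symm i).1 = f ∧ (quarkEquiv.symm j).1 = g ∧ (quarkEquiv.symm i).2.1 = x ∧
              (quarkEquiv.symm j).2.1 = x ∧ (quarkEquiv.symm i).2.2.1 = (quarkEquiv.symm j).2.2.1 then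
            Complex.I * gammaFive (quarkEquiv.symm i).2.2.2 (quarkEquiv.symm j).2.2.2 else 0) := by
  intro Nf L _ Γs f g x
  refine ⟨StubLocalBilinearEqQuadratic.local_bilinear_eq_quadratic Γs f g x, ?_⟩
  rw [pseudoscalarBilinear]
  exact StubLocalBilinearEqQuadratic.local_bilinear_eq_quadratic
    (Matrix.of fun α β => Complex.I * gammaFive α β) f g x

end Summit.QuantumFields.QCD.Cruxes.RobustYangMillsHandover.PinTheInfimum
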